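import Mathlib

/-!
# SoloBlind — the twisted Hochschild identity behind the thickened `p`-closedness theorem (paper §16.1)

Context (solo-blind programme on `ResolutionOfSingularities`, W-side, point dynamics `N₃`).  For a boundary
component `E = {x = 0}` of multiplicity `m` of an automorphism `σ` of order `p` of `k[[x,y,z]]`
(`δ = σ − 1`, `δ(𝒪) ⊆ x^m 𝒪`, `δ^p = 0`), the operator `L = x^{-m} δ` induces a derivation `Δ` of
`𝒪/(x^m)` and telescoping `δ^p = 0` through the powers `x^{km}` gives
`Π_{i=p-1}^{0} (Δ + (j + i m) a) = 0` on `𝒪/(x^m)` for every `j` (`a` the multiplier of `E`).  The product is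
unfolded by the *twisted Hochschild identity*: for a derivation `D` of a commutative ring of characteristic `p`
and an element `c`,
`(D + (p-1)c) ∘ ⋯ ∘ (D + c) ∘ D = D^p + R_c · D`, `R_c = [(D + (p-1)c) ∘ ⋯ ∘ (D + c)](1)`,
(proof: extend `D` to `A[g, g⁻¹]` by `Dg = cg` and apply Hochschild's formula `(gD)^p = g^p D^p + (gD)^{p-1}(g)·D`,
Matsumura, *Commutative Ring Theory*, Thm 25.5).  Consequently `Δ^p = −R · Δ` with an explicit `R`, which is
Theorem R of the paper (`m = 1`) with the multiplier made explicit, and new layer identities for `m ≥ 2`.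

This file lands the identity for `p = 3` and `p = 5` (the cases used in the computations of §16.2) as sorry-free ring
statements: for an additive map `D` satisfying the Leibniz rule on a commutative ring with `3 = 0`,
`(D + 2c)((D + c)(D f)) = D³ f + (D c + 2 c²) · D f`, together with the specialisation `c = m·a` that is
used at a boundary component, and the `p = 2` instance (which holds in every characteristic).
-/

namespace Summit.ResolutionOfSingularities.ResolutionOfSingularities.Theorems.SoloBlind

variable {A : Type*} [CommRing A]

/-- A Leibniz map kills `1`. -/
theorem leibniz_map_one (D : A →+ A) (hD : ∀ a b : A, D (a * b) = a * D b + b * D a) : D 1 = 0 := by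
  simpa using hD 1 1

/-- A Leibniz map kills every natural-number cast. -/
theorem leibniz_map_natCast (D : A →+ A) (hD : ∀ a b : A, D (a * b) = a * D b + b * D a) (n : ℕ) :
    D (n : A) = 0 := by
  induction n with
  | zero => simp
  | succ k ih =>
    push_cast
    rw [map_add, ih, leibniz_map_one D hD, add_zero]

/-- Twisted Hochschild identity, `p = 2` (valid in any commutative ring): `(D + c)(D f) = D² f + R_c · D f`
with `R_c = (D + c)(1) = D 1 + c = c`. Recorded for completeness of the pattern. -/
theorem twistedHochschild_two (D : A →+ A) (hD : ∀ a b : A, D (a * b) = a * D b + b * D a) (c f : A) :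
    D (D f) + c * D f = D (D f) + (D 1 + c * 1) * D f := by
  simp [leibniz_map_one D hD]

/-- Twisted Hochschild identity, `p = 3`: for an additive Leibniz map `D` on a commutative ring in which `3 = 0`
and any element `c`,  `(D + 2c)((D + c)(D f)) = D³ f + (D c + 2c²)·D f`.  Here
`R_c = [(D + 2c)(D + c)](1) = (D + 2c)(c) = D c + 2 c²`. -/
theorem twistedHochschild_three (D : A →+ A) (hD : ∀ a b : A, D (a * b) = a * D b + b * D a)
    (h3 : (3 : A) = 0) (c f : A) :
    D (D (D f) + c * D f) + 2 * c * (D (D f) + c * D f)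
      = D (D (D f)) + (D c + 2 * c * c) * D f := by
  rw [map_add, hD]
  linear_combination (c * D (D f)) * h3

/-- `R_c` for `p = 3` is literally `[(D + 2c) ∘ (D + c)](1)`: `(D + 2c)(D 1 + c·1) = D c + 2c²`. -/
theorem twistedHochschild_three_R (D : A →+ A) (hD : ∀ a b : A, D (a * b) = a * D b + b * D a) (c : A) :
    D (D 1 + c * 1) + 2 * c * (D 1 + c * 1) = D c + 2 * c * c := by
  simp [leibniz_map_one D hD]

/-- The form used at a boundary component of multiplicity `m` with multiplier `a` (`c = m a`), `p = 3`:
`(Δ + 2ma)((Δ + ma)(Δ f)) = Δ³ f + (m Δ a + 2 m² a²) Δ f`; in particular for `3 ∣ m` the twist disappears. -/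
theorem twistedHochschild_three_multiplier (D : A →+ A) (hD : ∀ a b : A, D (a * b) = a * D b + b * D a)
    (h3 : (3 : A) = 0) (m : ℕ) (a f : A) :
    D (D (D f) + (m : A) * a * D f) + 2 * ((m : A) * a) * (D (D f) + (m : A) * a * D f)
      = D (D (D f)) + ((m : A) * D a + 2 * (m : A) ^ 2 * a ^ 2) * D f := by
  have h := twistedHochschild_three D hD h3 ((m : A) * a) f
  have hDm : D ((m : A) * a) = (m : A) * D a := by
    rw [hD, leibniz_map_natCast D hD m]; ring
  have e1 : (m : A) * a * D f = ((m : A) * a) * D f := by ring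
  rw [e1, h, hDm]; ring

/-- When `3 ∣ m` the twisted product collapses to the plain cube: `(Δ + 2ma)((Δ + ma)(Δ f)) = Δ³ f`. -/
theorem twistedHochschild_three_multiplier_dvd (D : A →+ A) (hD : ∀ a b : A, D (a * b) = a * D b + b * D a)
    (h3 : (3 : A) = 0) (m : ℕ) (hm : 3 ∣ m) (a f : A) :
    D (D (D f) + (m : A) * a * D f) + 2 * ((m : A) * a) * (D (D f) + (m : A) * a * D f)
      = D (D (D f)) := by
  have hm0 : (m : A) = 0 := by
    obtain ⟨k, rfl⟩ := hm
    push_cast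
    rw [h3, zero_mul]
  rw [twistedHochschild_three_multiplier D hD h3 m a f, hm0]; ring

/-- A Leibniz map kills numerals. -/
theorem leibniz_map_ofNat (D : A →+ A) (hD : ∀ a b : A, D (a * b) = a * D b + b * D a) (n : ℕ)
    [n.AtLeastTwo] : D (OfNat.ofNat n : A) = 0 := by
  rw [← Nat.cast_ofNat]; exact leibniz_map_natCast D hD n

/-- Twisted Hochschild identity, `p = 5`: for an additive Leibniz map `D` on a commutative ring in which `5 = 0`
and any `c`, writing `T_k g = D g + k·c·g`,
`T₄(T₃(T₂(T₁(D f)))) = D⁵ f + R_c · D f` with `R_c = T₄(T₃(T₂(T₁ 1)))` (both sides written out literally).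
The proof is the brute-force expansion; the certificate is `(LHS − RHS)/5`, computed by `work/s10/th5.py`. -/
theorem twistedHochschild_five (D : A →+ A) (hD : ∀ a b : A, D (a * b) = a * D b + b * D a)
    (h5 : (5 : A) = 0) (c f : A) :
    D (D (D (D (D f) + c * D f) + 2 * c * (D (D f) + c * D f))
          + 3 * c * (D (D (D f) + c * D f) + 2 * c * (D (D f) + c * D f)))
      + 4 * c * (D (D (D (D f) + c * D f) + 2 * c * (D (D f) + c * D f))
          + 3 * c * (D (D (D f) + c * D f) + 2 * c * (D (D f) + c * D f)))
    = D (D (D (D (D f))))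
      + (D (D (D (D 1 + c * 1) + 2 * c * (D 1 + c * 1)) + 3 * c * (D (D 1 + c * 1) + 2 * c * (D 1 + c * 1)))
          + 4 * c * (D (D (D 1 + c * 1) + 2 * c * (D 1 + c * 1)) + 3 * c * (D (D 1 + c * 1) + 2 * c * (D 1 + c * 1))))
        * D f := by
  simp only [map_add, hD, leibniz_map_one D hD, leibniz_map_ofNat D hD, mul_zero, add_zero, zero_add, mul_one]
  linear_combination ((10 : A) * c * c * c * (D (D f)) + (7 : A) * c * c * (D (D (D f)))
    + (9 : A) * c * (D c) * (D (D f)) + (2 : A) * c * (D (D (D (D f)))) + (2 : A) * (D c) * (D (D (D f)))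
    + (1 : A) * (D (D c)) * (D (D f))) * h5

/-- The `p = 5` multiplier `R_c = [(D+4c)(D+3c)(D+2c)(D+c)](1)` in closed form:
`R_c = D³c + 7 (Dc)² + 11 c·D²c + 46 c²·Dc + 24 c⁴` (`≡ D³c + 2(Dc)² + c D²c + c² Dc − c⁴ (mod 5)`). -/
theorem twistedHochschild_five_R (D : A →+ A) (hD : ∀ a b : A, D (a * b) = a * D b + b * D a) (c : A) :
    D (D (D (D 1 + c * 1) + 2 * c * (D 1 + c * 1)) + 3 * c * (D (D 1 + c * 1) + 2 * c * (D 1 + c * 1)))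
      + 4 * c * (D (D (D 1 + c * 1) + 2 * c * (D 1 + c * 1)) + 3 * c * (D (D 1 + c * 1) + 2 * c * (D 1 + c * 1)))
    = D (D (D c)) + 7 * D c * D c + 11 * c * D (D c) + 46 * c * c * D c + 24 * c * c * c * c := by
  simp only [map_add, hD, leibniz_map_one D hD, leibniz_map_ofNat D hD, mul_zero, add_zero, zero_add, mul_one]
  ring

end Summit.ResolutionOfSingularities.ResolutionOfSingularities.Theorems.SoloBlind
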